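import Literature.Computability.AlgebraicComplexity.HI16BinaryDC
import Literature.Computability.AlgebraicComplexity.CircuitGateSemantics
import Literature.Computability.AlgebraicComplexity.SymmetricDetRepresentationProofs
import HarnessLib

/-!
# `DET⁰ ⊆ VP_s⁰` — the inclusion of Hüttenhain–Ikenmeyer 2016, Prop. 5.2, via a constant-free
# skew circuit for the determinant (Mahajan–Vinay clow dynamics)

Theorem-only companion of `Literature/Computability/AlgebraicComplexity/HI16BinaryDC.lean` (cell
`val-lit`, seat t15; the named fact `huttenhainIkenmeyer2016_prop12 : ∀ f, IsVPsZeroFamily f ↔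
IsDETZeroFamily f` is split by direction between t14 (`⊆`, Toda's direction, and the final
`_holds`) and this file (`⊇`)). Honest framing: a 2016 model inclusion between two constant-free
classes, formalised from a published construction; VP ≠ VNP is NOT proved and nothing here is
progress on it.

## Statement (AS PRINTED) and proof (AS PROVED)

J. Hüttenhain, C. Ikenmeyer, *Binary determinantal complexity*, Linear Algebra Appl. 504 (2016)
= arXiv:1410.8202, §5, Proposition 5.2 (held text `paper:arxiv-1410.8202 p0009:L32–L33`, flat
numbering "Proposition 12"): "`VP_s^0 = DET^0`", whose proof begins (p0009:L36) "The proof of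
[toda:92] immediately shows that `DET^0 ⊆ VP_s^0`." This file proves exactly that inclusion on the
tree's renderings `IsDETZeroFamily` / `IsVPsZeroFamily` (HI16BinaryDC, §5 classes):

* `isVPsZeroFamily_of_isDETZeroFamily` — **`DET⁰ ⊆ VP_s⁰`**: a family `f` with binary variable
  matrices `A_n` of polynomially bounded size `s(n)` and `det A_n = f_n` has constant-free
  (constants and sum coefficients in `{0, 1, -1}`), skew, fan-in-two circuits of polynomially
  bounded size computing `f_n`.

AS PROVED (route deviation, disclosed): instead of Toda's 1992 argument we use the skew circuit
read off the **Mahajan–Vinay 1997 clow dynamics** for the determinant in Berkowitz's orientation,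
which the tree already has as `GKKP2011.sv` with its invariants `GKKP2011.sv_succ` /
`GKKP2011.sum_sv_diag` (`SymmetricDetRepresentationProofs.lean`, Part B): every summand of
`sv (d+1) t u = ∑_{w<t} sv d t w · step(w,t,u) + B_d(t) · step(t,t,u)` is (earlier value) ×
(input `X_{wu}`), the sign `±1` of a closing edge being carried by the coefficient of the
fan-in-two accumulation gates — so every product gate has an input as one of its two operands
(skew), all constants are `0, 1, -1`, and the size is `≤ 4 (s+1)^4`
(`exists_skew_circuit_detPoly`). The binary variable matrix is then fed in by an **input
substitution** `X_{ij} ↦ A_{ij} ∈ {0, 1, X v}` (`ArithCircuit.substIn`), which keeps size, fan-in,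
skewness and sign constants (`exists_skew_circuit_of_hasBinaryDetRepr`), and p-boundedness of the
size follows from that of `s` (no bound on the number of variables is needed — the caveat recorded
on `IsVPsZeroFamily` is not touched by this direction).

## Infrastructure (generic, reusable)

* Part 1, `ArithCircuit.substIn`: substitution of inputs (variables or constants) for variables,
  with `eval_substIn : (P.substIn φ).eval = aeval (inputVal φ) P.eval` and preservation lemmas.
* Part 2, `ArithCircuit.RegProg`: **register programs** — gates addressed by NAME with a rank
  function, compiled to the tree's absolute-index `ArithCircuit` by sorting on rank
  (`RegProg.compile`, `List.mergeSort`); correctness `RegProg.eval_compile` from two local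
  hypotheses, `WellRanked` (reads go to registers of smaller rank) and `Realizes` (each defining
  gate returns the intended value), proved gate by gate with `CircuitGateSemantics`
  (`gateVal_of_sum` / `gateVal_of_prod`). This replaces index bookkeeping in explicit circuit
  constructions.
* Part 3, `HI16Det.*`: the register program for `det_{m+1}` (registers `bm`/`pr`/`acc`/`out`),
  its local equations (`HI16Det.realizes`, key step `HI16Det.val_acc_self` = one layer of
  `GKKP2011.sv`), well-rankedness, shape and size.

No named facts; all proofs complete; definitions are constructions only (D-0026).

## References

* [HuttenhainIkenmeyer2016] J. Hüttenhain, C. Ikenmeyer, Linear Algebra Appl. 504 (2016),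
  arXiv:1410.8202, §5, Prop. 5.2 (p0009:L32–L36).
* [MahajanVinay1997] M. Mahajan, V. Vinay, *Determinant: combinatorics, algorithms, and
  complexity*, Chicago J. Theoret. Comput. Sci. 1997, Art. 5, §3 (clow sequences; Thm. 2).
* [Burgisser2000] P. Bürgisser, *Completeness and Reduction in Algebraic Complexity Theory*,
  Springer 2000, Def. 2.1, Rem. 2.2, §1.4 (straight-line programs, renaming, constant-free model).
* S. Toda, *Classes of arithmetic circuits capturing the complexity of computing the determinant*,
  IEICE Trans. Inf. Syst. E75-D (1992) — the source's citation [toda:92], not followed here.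
-/

noncomputable section

open MvPolynomial

namespace Literature.Computability.AlgebraicComplexity

universe u v w

namespace ArithCircuit

/-! ## Part 1. Substituting inputs (variables or constants) for the variables of a circuit -/

section SubstIn

variable {k : Type u} {σ : Type v} {τ : Type w}

/-- The input operand denoted by an element of `τ ⊕ k`: a variable of `τ` or a constant of `k`
(Bürgisser 2000, Def. 2.1: the inputs of a straight-line program). [cite: Burgisser2000, Def. 2.1] -/
def Operand.ofInput : τ ⊕ k → Operand k τ
  | .inl j => .var j
  | .inr c => .const c

/-- Substitute the input `φ i` (a variable or a constant) for the variable `X i` in an operand;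
constants and gate references are unchanged. [cite: Burgisser2000, Def. 2.1] -/
def Operand.substIn (φ : σ → τ ⊕ k) : Operand k σ → Operand k τ
  | .var i => Operand.ofInput (φ i)
  | .const c => .const c
  | .gate j => .gate j

/-- Substitute inputs for the variables of a gate (operand-wise). [cite: Burgisser2000, Def. 2.1] -/
def Gate.substIn (φ : σ → τ ⊕ k) : Gate k σ → Gate k τ
  | .sum args => .sum (args.map fun a => (a.1, a.2.substIn φ))
  | .prod args => .prod (args.map (Operand.substIn φ))

/-- **Input substitution** `X i ↦ φ i ∈ {variables} ∪ {constants}` in a circuit: the same gates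
with relabelled inputs (Bürgisser 2000, Def. 2.1 / Rem. 2.2; the case of a substitution by
variables is `ArithCircuit.rename`). It computes `aeval (inputVal φ) P.eval` (`eval_substIn`)
and has the same size, fan-in and skewness. [cite: Burgisser2000, Rem. 2.2] -/
def substIn (φ : σ → τ ⊕ k) (P : ArithCircuit k σ) : ArithCircuit k τ where
  gates := P.gates.map (Gate.substIn φ)
  output := P.output.substIn φ

/-- The size is unchanged by an input substitution. [cite: Burgisser2000, Rem. 2.2] -/
@[simp]
theorem size_substIn (φ : σ → τ ⊕ k) (P : ArithCircuit k σ) : (P.substIn φ).size = P.size := by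
  simp [substIn, size]

/-- The operands of a substituted gate are the substituted operands. [cite: Burgisser2000, Rem. 2.2] -/
theorem Gate.args_substIn (φ : σ → τ ⊕ k) (g : Gate k σ) :
    (g.substIn φ).args = g.args.map (Operand.substIn φ) := by
  cases g with
  | sum args => simp [Gate.substIn, Gate.args, List.map_map, Function.comp_def]
  | prod args => rfl

/-- Input substitution preserves the fan-in of every gate. [cite: Burgisser2000, Rem. 2.2] -/
theorem Gate.fanIn_substIn (φ : σ → τ ⊕ k) (g : Gate k σ) : (g.substIn φ).fanIn = g.fanIn := by
  rw [Gate.fanIn, Gate.fanIn, Gate.args_substIn, List.length_map]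

/-- Input substitution preserves fan-in two. [cite: Burgisser2000, Rem. 2.2] -/
theorem IsFanInTwo.substIn {P : ArithCircuit k σ} (h : P.IsFanInTwo) (φ : σ → τ ⊕ k) :
    (P.substIn φ).IsFanInTwo := by
  intro g hg
  simp only [ArithCircuit.substIn, List.mem_map] at hg
  obtain ⟨g', hg', rfl⟩ := hg
  rw [Gate.fanIn_substIn]
  exact h g' hg'

/-- An input substitution does not create gate references. [cite: Burgisser2000, Rem. 2.2] -/
theorem Operand.isGateRef_substIn (φ : σ → τ ⊕ k) (u : Operand k σ) :
    (u.substIn φ).isGateRef = u.isGateRef := by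
  cases u with
  | var i =>
    simp only [Operand.substIn]
    cases φ i <;> rfl
  | const c => rfl
  | gate j => rfl

/-- Input substitution preserves skewness of gates. [cite: HuttenhainIkenmeyer2016, §5] -/
theorem Gate.IsSkew.substIn {g : Gate k σ} (h : g.IsSkew) (φ : σ → τ ⊕ k) :
    (g.substIn φ).IsSkew := by
  cases g with
  | sum args => trivial
  | prod args =>
    simp only [Gate.IsSkew, Gate.substIn, List.countP_map] at h ⊢
    have hc : (Operand.isGateRef ∘ Operand.substIn φ : Operand k σ → Bool) = Operand.isGateRef :=
      funext fun u => Operand.isGateRef_substIn φ u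
    rw [hc]
    exact h

/-- Input substitution preserves skewness of circuits. [cite: HuttenhainIkenmeyer2016, §5] -/
theorem IsSkew.substIn {P : ArithCircuit k σ} (h : P.IsSkew) (φ : σ → τ ⊕ k) :
    (P.substIn φ).IsSkew := by
  intro g hg
  simp only [ArithCircuit.substIn, List.mem_map] at hg
  obtain ⟨g', hg', rfl⟩ := hg
  exact (h g' hg').substIn φ

section Sign

variable [Zero k] [One k] [Add k]

/-- The substituted constants of `φ` all lie in `{0, 1, -1}`. [cite: Burgisser2000, §1.4] -/
def SignInputs (φ : σ → τ ⊕ k) : Prop :=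
  ∀ i c, φ i = .inr c → IsSignConstant c

/-- Substituting sign constants preserves the sign-constants property of operands.
[cite: Burgisser2000, §1.4] -/
theorem Operand.HasSignConstants.substIn {φ : σ → τ ⊕ k} (hφ : SignInputs φ) {u : Operand k σ}
    (h : u.HasSignConstants) : (u.substIn φ).HasSignConstants := by
  cases u with
  | var i =>
    simp only [Operand.substIn]
    rcases hi : φ i with j | c
    · trivial
    · exact hφ i c hi
  | const c => exact h
  | gate j => trivial

/-- Substituting sign constants preserves the sign-constants property of gates.
[cite: Burgisser2000, §1.4] -/
theorem Gate.HasSignConstants.substIn {φ : σ → τ ⊕ k} (hφ : SignInputs φ) {g : Gate k σ}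
    (h : g.HasSignConstants) : (g.substIn φ).HasSignConstants := by
  cases g with
  | sum args =>
    intro a ha
    simp only [List.mem_map] at ha
    obtain ⟨a', ha', rfl⟩ := ha
    exact ⟨(h a' ha').1, (h a' ha').2.substIn hφ⟩
  | prod args =>
    intro u hu
    simp only [List.mem_map] at hu
    obtain ⟨u', hu', rfl⟩ := hu
    exact (h u' hu').substIn hφ

/-- Substituting sign constants preserves constant-freeness of circuits.
[cite: Burgisser2000, §1.4] -/
theorem HasSignConstants.substIn {φ : σ → τ ⊕ k} (hφ : SignInputs φ) {P : ArithCircuit k σ}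
    (h : P.HasSignConstants) : (P.substIn φ).HasSignConstants := by
  refine ⟨fun g hg => ?_, h.2.substIn hφ⟩
  simp only [ArithCircuit.substIn, List.mem_map] at hg
  obtain ⟨g', hg', rfl⟩ := hg
  exact (h.1 g' hg').substIn hφ

end Sign

variable [CommSemiring k]

/-- The polynomial substituted for `X i`: the variable or the constant `φ i`.
[cite: Burgisser2000, Rem. 2.2] -/
def inputVal (φ : σ → τ ⊕ k) (i : σ) : MvPolynomial τ k :=
  Sum.elim X C (φ i)

omit [CommSemiring k] in
/-- Unfolding `inputVal` on a variable input. [cite: Burgisser2000, Rem. 2.2] -/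
theorem inputVal_of_inl [CommSemiring k] {φ : σ → τ ⊕ k} {i : σ} {j : τ} (h : φ i = .inl j) :
    inputVal φ i = X j := by
  simp [inputVal, h]

omit [CommSemiring k] in
/-- Unfolding `inputVal` on a constant input. [cite: Burgisser2000, Rem. 2.2] -/
theorem inputVal_of_inr [CommSemiring k] {φ : σ → τ ⊕ k} {i : σ} {c : k} (h : φ i = .inr c) :
    inputVal φ i = C c := by
  simp [inputVal, h]

/-- A substituted operand, read against the substituted value list, evaluates to the substituted
value (the junk value `0` is fixed by `aeval`). [cite: Burgisser2000, Rem. 2.2] -/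
private theorem Operand.eval_substIn (φ : σ → τ ⊕ k) (vals : List (MvPolynomial σ k))
    (u : Operand k σ) :
    (u.substIn φ).eval (vals.map (aeval (inputVal φ))) = aeval (inputVal φ) (u.eval vals) := by
  cases u with
  | var i =>
    simp only [Operand.substIn, Operand.eval, aeval_X, inputVal]
    cases φ i <;> rfl
  | const c => simp [Operand.substIn, Operand.eval]
  | gate j =>
    simp only [Operand.substIn, Operand.eval, List.getD_eq_getElem?_getD, List.getElem?_map]
    cases vals[j]? <;> simp

/-- A substituted gate, read against the substituted value list, evaluates to the substituted
value (`aeval` commutes with weighted sums and products). [cite: Burgisser2000, Rem. 2.2] -/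
private theorem Gate.eval_substIn (φ : σ → τ ⊕ k) (vals : List (MvPolynomial σ k)) (g : Gate k σ) :
    (g.substIn φ).eval (vals.map (aeval (inputVal φ))) = aeval (inputVal φ) (g.eval vals) := by
  cases g with
  | sum args =>
    simp only [Gate.substIn, Gate.eval, List.map_map, map_list_sum]
    congr 1
    refine List.map_congr_left fun a _ => ?_
    simp only [Function.comp_apply, smul_eq_C_mul, map_mul, algHom_C, MvPolynomial.algebraMap_eq,
      Operand.eval_substIn]
  | prod args =>
    simp only [Gate.substIn, Gate.eval, List.map_map, map_list_prod]
    congr 1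
    refine List.map_congr_left fun u _ => ?_
    simp only [Function.comp_apply, Operand.eval_substIn]

/-- The value list of a substituted gate list is the substituted value list.
[cite: Burgisser2000, Rem. 2.2] -/
private theorem gateValues_substIn (φ : σ → τ ⊕ k) (gs : List (Gate k σ)) :
    gateValues (gs.map (Gate.substIn φ)) = (gateValues gs).map (aeval (inputVal φ)) := by
  induction gs using List.reverseRecOn with
  | nil => rfl
  | append_singleton gs g ih =>
    rw [List.map_append, List.map_singleton, gateValues_append_singleton,
      gateValues_append_singleton, ih, Gate.eval_substIn, List.map_append, List.map_singleton]

/-- **Semantics of input substitution**: `(P.substIn φ).eval = aeval (inputVal φ) P.eval`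
(Bürgisser 2000, Rem. 2.2). [cite: Burgisser2000, Rem. 2.2] -/
theorem eval_substIn (φ : σ → τ ⊕ k) (P : ArithCircuit k σ) :
    (P.substIn φ).eval = aeval (inputVal φ) P.eval := by
  change (P.output.substIn φ).eval (gateValues (P.gates.map (Gate.substIn φ))) = _
  rw [gateValues_substIn, Operand.eval_substIn]
  rfl

end SubstIn

/-! ## Part 2. Register programs: circuits with named gates, compiled by rank -/

/-- An operand of a register program: a variable, a constant, or a reference to a NAMED register
`r : ρ` (instead of an absolute gate index). [cite: Burgisser2000, Def. 2.1] -/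
inductive ROperand (k : Type u) (σ : Type v) (ρ : Type w) : Type max u v w
  /-- The input variable `X i`. -/
  | var (i : σ) : ROperand k σ ρ
  /-- The scalar constant `c`. -/
  | const (c : k) : ROperand k σ ρ
  /-- A reference to the value of the register `r`. -/
  | reg (r : ρ) : ROperand k σ ρ

/-- A gate of a register program: a weighted sum or a product of register operands.
[cite: Burgisser2000, Def. 2.1] -/
inductive RGate (k : Type u) (σ : Type v) (ρ : Type w) : Type max u v w
  /-- Weighted-sum gate. -/
  | sum (args : List (k × ROperand k σ ρ)) : RGate k σ ρ
  /-- Product gate. -/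
  | prod (args : List (ROperand k σ ρ)) : RGate k σ ρ

section Reg

variable {k : Type u} {σ : Type v} {ρ : Type w}

namespace ROperand

/-- The value of a register operand given the values `val` of all registers.
[cite: Burgisser2000, Def. 2.1] -/
def eval [CommSemiring k] (val : ρ → MvPolynomial σ k) : ROperand k σ ρ → MvPolynomial σ k
  | var i => X i
  | const c => C c
  | reg r => val r

/-- The registers read by an operand. [cite: Burgisser2000, Def. 2.1] -/
def reads : ROperand k σ ρ → List ρ
  | reg r => [r]
  | _ => []

/-- A variable operand denotes the variable. [cite: Burgisser2000, Def. 2.1] -/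
@[simp] theorem eval_var [CommSemiring k] (val : ρ → MvPolynomial σ k) (i : σ) :
    (var i : ROperand k σ ρ).eval val = X i := rfl

/-- A constant operand denotes the constant. [cite: Burgisser2000, Def. 2.1] -/
@[simp] theorem eval_const [CommSemiring k] (val : ρ → MvPolynomial σ k) (c : k) :
    (const c : ROperand k σ ρ).eval val = C c := rfl

/-- A register operand denotes the value of the register. [cite: Burgisser2000, Def. 2.1] -/
@[simp] theorem eval_reg [CommSemiring k] (val : ρ → MvPolynomial σ k) (r : ρ) :
    (reg r : ROperand k σ ρ).eval val = val r := rfl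

/-- A variable operand reads no register. [cite: Burgisser2000, Def. 2.1] -/
@[simp] theorem reads_var (i : σ) : (var i : ROperand k σ ρ).reads = [] := rfl

/-- A constant operand reads no register. [cite: Burgisser2000, Def. 2.1] -/
@[simp] theorem reads_const (c : k) : (const c : ROperand k σ ρ).reads = [] := rfl

/-- A register operand reads its register. [cite: Burgisser2000, Def. 2.1] -/
@[simp] theorem reads_reg (r : ρ) : (reg r : ROperand k σ ρ).reads = [r] := rfl

/-- Translation to a circuit operand, given the absolute positions of the registers.
[cite: Burgisser2000, Def. 2.1] -/
def tr (pos : ρ → ℕ) : ROperand k σ ρ → Operand k σ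
  | var i => .var i
  | const c => .const c
  | reg r => .gate (pos r)

/-- An operand has sign constants if it is not a constant outside `{0, 1, -1}`.
[cite: Burgisser2000, §1.4] -/
def HasSignConstants [Zero k] [One k] [Add k] : ROperand k σ ρ → Prop
  | const c => IsSignConstant c
  | _ => True

/-- Whether an operand is a register reference. [cite: HuttenhainIkenmeyer2016, §5] -/
def isRegRef : ROperand k σ ρ → Bool
  | reg _ => true
  | _ => false

end ROperand

namespace RGate

/-- The value of a register gate given the values of all registers. [cite: Burgisser2000, Def. 2.1] -/
def eval [CommSemiring k] (val : ρ → MvPolynomial σ k) : RGate k σ ρ → MvPolynomial σ k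
  | sum args => (args.map fun a => a.1 • a.2.eval val).sum
  | prod args => (args.map (ROperand.eval val)).prod

/-- The registers read by a gate. [cite: Burgisser2000, Def. 2.1] -/
def reads : RGate k σ ρ → List ρ
  | sum args => args.flatMap fun a => a.2.reads
  | prod args => args.flatMap ROperand.reads

/-- Translation to a circuit gate, given the absolute positions of the registers.
[cite: Burgisser2000, Def. 2.1] -/
def tr (pos : ρ → ℕ) : RGate k σ ρ → Gate k σ
  | sum args => .sum (args.map fun a => (a.1, a.2.tr pos))
  | prod args => .prod (args.map (ROperand.tr pos))

/-- The fan-in of a register gate. [cite: Burgisser2000, Def. 2.1] -/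
def fanIn : RGate k σ ρ → ℕ
  | sum args => args.length
  | prod args => args.length

/-- A register gate has sign constants if all its constants and sum coefficients lie in
`{0, 1, -1}`. [cite: Burgisser2000, §1.4] -/
def HasSignConstants [Zero k] [One k] [Add k] : RGate k σ ρ → Prop
  | sum args => ∀ a ∈ args, IsSignConstant a.1 ∧ a.2.HasSignConstants
  | prod args => ∀ u ∈ args, u.HasSignConstants

/-- A register gate is skew if it is a sum gate, or a product gate at most one of whose operands
is a register reference. [cite: HuttenhainIkenmeyer2016, §5] -/
def IsSkew : RGate k σ ρ → Prop
  | prod args => args.countP ROperand.isRegRef ≤ 1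
  | sum _ => True

/-- The fan-in of the translated gate is that of the register gate. [cite: Burgisser2000, Def. 2.1] -/
theorem fanIn_tr (pos : ρ → ℕ) (g : RGate k σ ρ) : (g.tr pos).fanIn = g.fanIn := by
  cases g <;> simp [tr, fanIn, Gate.fanIn, Gate.args]

/-- Translation preserves the sign-constants property. [cite: Burgisser2000, §1.4] -/
theorem hasSignConstants_tr [Zero k] [One k] [Add k] (pos : ρ → ℕ) {g : RGate k σ ρ}
    (h : g.HasSignConstants) : (g.tr pos).HasSignConstants := by
  cases g with
  | sum args =>
    intro a ha
    simp only [List.mem_map] at ha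
    obtain ⟨a', ha', rfl⟩ := ha
    refine ⟨(h a' ha').1, ?_⟩
    rcases a' with ⟨c, u⟩
    cases u with
    | var i => trivial
    | const c' => exact (h _ ha').2
    | reg r => trivial
  | prod args =>
    intro u hu
    simp only [List.mem_map] at hu
    obtain ⟨u', hu', rfl⟩ := hu
    cases u' with
    | var i => trivial
    | const c' => exact h _ hu'
    | reg r => trivial

/-- Translation preserves skewness. [cite: HuttenhainIkenmeyer2016, §5] -/
theorem isSkew_tr (pos : ρ → ℕ) {g : RGate k σ ρ} (h : g.IsSkew) : (g.tr pos).IsSkew := by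
  cases g with
  | sum args => trivial
  | prod args =>
    simp only [IsSkew, tr, Gate.IsSkew, List.countP_map] at h ⊢
    have hc : (Operand.isGateRef ∘ ROperand.tr pos : ROperand k σ ρ → Bool) = ROperand.isRegRef :=
      funext fun u => by cases u <;> rfl
    rw [hc]
    exact h

end RGate

/-- A **register program**: a finite list of named registers `regs`, each with a defining gate
`gateOf r` over register operands, a `rank` (a register may only read registers of smaller rank)
and an output operand. It is compiled to an `ArithCircuit` by listing the registers in order of
rank (`RegProg.compile`); this replaces absolute gate-index bookkeeping by names.
[cite: Burgisser2000, Def. 2.1] -/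
structure RegProg (k : Type u) (σ : Type v) (ρ : Type w) : Type max u v w where
  /-- The registers (in any order). -/
  regs : List ρ
  /-- The rank: every register reads only registers of strictly smaller rank. -/
  rank : ρ → ℕ
  /-- The defining gate of each register. -/
  gateOf : ρ → RGate k σ ρ
  /-- The output operand. -/
  output : ROperand k σ ρ

namespace RegProg

/-- **Well-ranked** register programs: every register reads only registers of the program of
strictly smaller rank (so the rank-sorted gate list is a straight-line program).
[cite: Burgisser2000, Def. 2.1] -/
def WellRanked (R : RegProg k σ ρ) : Prop :=
  ∀ r ∈ R.regs, ∀ r' ∈ (R.gateOf r).reads, r' ∈ R.regs ∧ R.rank r' < R.rank r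

/-- `val` **realizes** the program `R`: each defining gate, evaluated at `val`, returns `val` of
its register (the local equations of the straight-line program). [cite: Burgisser2000, Def. 2.1] -/
def Realizes [CommSemiring k] (R : RegProg k σ ρ) (val : ρ → MvPolynomial σ k) : Prop :=
  ∀ r, (R.gateOf r).eval val = val r

variable (R : RegProg k σ ρ)

/-- The registers sorted by rank (stable merge sort). [cite: Burgisser2000, Def. 2.1] -/
def sorted : List ρ :=
  R.regs.mergeSort fun a b => decide (R.rank a ≤ R.rank b)

/-- Membership in the sorted register list. [cite: Burgisser2000, Def. 2.1] -/
theorem mem_sorted {r : ρ} : r ∈ R.sorted ↔ r ∈ R.regs :=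
  List.mem_mergeSort

/-- The sorted list has one entry per register. [cite: Burgisser2000, Def. 2.1] -/
theorem length_sorted : R.sorted.length = R.regs.length :=
  List.length_mergeSort _

/-- The sorted register list is sorted by rank. [cite: Burgisser2000, Def. 2.1] -/
theorem pairwise_sorted : R.sorted.Pairwise fun a b => R.rank a ≤ R.rank b := by
  have h := List.pairwise_mergeSort (le := fun a b => decide (R.rank a ≤ R.rank b))
    (fun a b c hab hbc => by
      simp only [decide_eq_true_eq] at hab hbc ⊢
      exact hab.trans hbc)
    (fun a b => by
      simp only [Bool.or_eq_true, decide_eq_true_eq]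
      exact le_total _ _) R.regs
  simpa [sorted] using h

variable [DecidableEq ρ]

/-- The absolute position of a register: its first index in the rank-sorted list.
[cite: Burgisser2000, Def. 2.1] -/
def pos (r : ρ) : ℕ :=
  R.sorted.idxOf r

/-- **Compilation** of a register program to a straight-line circuit: the defining gates in order
of rank, register references replaced by positions. [cite: Burgisser2000, Def. 2.1] -/
def compile : ArithCircuit k σ where
  gates := R.sorted.map fun r => (R.gateOf r).tr R.pos
  output := R.output.tr R.pos

/-- The compiled circuit has one gate per register. [cite: Burgisser2000, Def. 2.1] -/
theorem size_compile : R.compile.size = R.regs.length := by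
  simp [compile, ArithCircuit.size, length_sorted]

/-- The compiled circuit has fan-in two if every register gate has. [cite: Burgisser2000, Def. 2.1] -/
theorem isFanInTwo_compile (h : ∀ r ∈ R.regs, (R.gateOf r).fanIn ≤ 2) : R.compile.IsFanInTwo := by
  intro g hg
  simp only [compile, List.mem_map] at hg
  obtain ⟨r, hr, rfl⟩ := hg
  rw [RGate.fanIn_tr]
  exact h r ((mem_sorted R).1 hr)

/-- The compiled circuit is constant-free if every register gate and the output are.
[cite: Burgisser2000, §1.4] -/
theorem hasSignConstants_compile [Zero k] [One k] [Add k]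
    (h : ∀ r ∈ R.regs, (R.gateOf r).HasSignConstants)
    (ho : R.output.HasSignConstants) : R.compile.HasSignConstants := by
  refine ⟨fun g hg => ?_, ?_⟩
  · simp only [compile, List.mem_map] at hg
    obtain ⟨r, hr, rfl⟩ := hg
    exact RGate.hasSignConstants_tr _ (h r ((mem_sorted R).1 hr))
  · change (R.output.tr R.pos).HasSignConstants
    cases hu : R.output with
    | var i => trivial
    | const c =>
      rw [hu] at ho
      exact ho
    | reg r => trivial

/-- The compiled circuit is skew if every register gate is. [cite: HuttenhainIkenmeyer2016, §5] -/
theorem isSkew_compile (h : ∀ r ∈ R.regs, (R.gateOf r).IsSkew) : R.compile.IsSkew := by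
  intro g hg
  simp only [compile, List.mem_map] at hg
  obtain ⟨r, hr, rfl⟩ := hg
  exact RGate.isSkew_tr _ (h r ((mem_sorted R).1 hr))

/-- The first index of the `i`-th entry is at most `i`. [folklore] -/
private theorem idxOf_getElem_le (l : List ρ) (i : ℕ) (hi : i < l.length) :
    l.idxOf l[i] ≤ i := by
  induction l generalizing i with
  | nil => simp at hi
  | cons x xs ih =>
    cases i with
    | zero => simp
    | succ j =>
      have hj : j < xs.length := by simpa using hi
      simp only [List.getElem_cons_succ, List.idxOf_cons]
      cases (x == xs[j]) <;> simp [ih j hj]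

/-- A register of the program sits at a valid position and is found there. [cite: Burgisser2000, Def. 2.1] -/
theorem pos_lt_length {r : ρ} (hr : r ∈ R.regs) : R.pos r < R.sorted.length :=
  List.idxOf_lt_length_of_mem ((mem_sorted R).2 hr)

/-- The register at its position. [cite: Burgisser2000, Def. 2.1] -/
theorem getElem_pos {r : ρ} (hr : r ∈ R.regs) : R.sorted[R.pos r]'(R.pos_lt_length hr) = r :=
  List.getElem_idxOf _

/-- Positions increase strictly with rank. [cite: Burgisser2000, Def. 2.1] -/
theorem pos_lt_pos_of_rank_lt {r r' : ρ} (hr : r ∈ R.regs) (hr' : r' ∈ R.regs)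
    (h : R.rank r' < R.rank r) : R.pos r' < R.pos r := by
  by_contra hle
  rw [not_lt] at hle
  rcases hle.eq_or_lt with heq | hlt
  · have h1 := R.getElem_pos hr
    have h2 := R.getElem_pos hr'
    have : r = r' := by
      rw [← h1, ← h2]
      simp only [heq]
    subst this
    exact lt_irrefl _ h
  · have hp := (List.pairwise_iff_getElem.1 (R.pairwise_sorted)) (R.pos r) (R.pos r')
      (R.pos_lt_length hr) (R.pos_lt_length hr') hlt
    rw [R.getElem_pos hr, R.getElem_pos hr'] at hp
    exact absurd h (not_lt.2 hp)

variable [CommSemiring k]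

/-- Reading a translated operand inside gate `i`: if all registers it reads sit at positions
`< i` where the compiled circuit already has the intended values, it reads the intended value.
[cite: Burgisser2000, Def. 2.1] -/
theorem opVal_tr {val : ρ → MvPolynomial σ k} {i : ℕ} (u : ROperand k σ ρ)
    (hu : ∀ r' ∈ u.reads, R.pos r' < i ∧ R.compile.gateVal (R.pos r') = val r') :
    R.compile.opVal i (u.tr R.pos) = u.eval val := by
  cases u with
  | var j => rfl
  | const c => rfl
  | reg r' =>
    obtain ⟨h1, h2⟩ := hu r' (by simp [ROperand.reads])
    simp [ROperand.tr, ROperand.eval, ArithCircuit.opVal_gate, h1, h2]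

/-- **Correctness of compilation, gate by gate**: in a well-ranked program realized by `val`,
gate number `i` of the compiled circuit has the value `val` of the `i`-th register in rank
order. [cite: Burgisser2000, Def. 2.1] -/
theorem gateVal_compile_sorted {val : ρ → MvPolynomial σ k} (hW : R.WellRanked)
    (hV : R.Realizes val) (i : ℕ) (hi : i < R.sorted.length) :
    R.compile.gateVal i = val R.sorted[i] := by
  induction i using Nat.strong_induction_on with
  | _ i ih =>
    have hmem : R.sorted[i] ∈ R.regs := (mem_sorted R).1 (List.getElem_mem hi)
    have hgate : R.compile.gates[i]? = some ((R.gateOf R.sorted[i]).tr R.pos) := by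
      simp [compile, List.getElem?_map, List.getElem?_eq_getElem hi]
    -- every register read by gate `i` sits at an earlier position with the intended value
    have hreads : ∀ r' ∈ (R.gateOf R.sorted[i]).reads,
        R.pos r' < i ∧ R.compile.gateVal (R.pos r') = val r' := by
      intro r' hr'
      obtain ⟨hr'mem, hrank⟩ := hW _ hmem r' hr'
      have hlt : R.pos r' < i :=
        (R.pos_lt_pos_of_rank_lt hmem hr'mem hrank).trans_le (idxOf_getElem_le R.sorted i hi)
      refine ⟨hlt, ?_⟩
      rw [ih _ hlt (R.pos_lt_length hr'mem), R.getElem_pos hr'mem]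
    rw [← hV R.sorted[i]]
    rcases hg : R.gateOf R.sorted[i] with args | args
    · rw [hg] at hgate hreads
      rw [ArithCircuit.gateVal_of_sum _ hgate, RGate.eval, List.map_map]
      congr 1
      refine List.map_congr_left fun a ha => ?_
      simp only [Function.comp_apply]
      rw [R.opVal_tr a.2 fun r' hr' => hreads r' ?_]
      simp only [RGate.reads, List.mem_flatMap]
      exact ⟨a, ha, hr'⟩
    · rw [hg] at hgate hreads
      rw [ArithCircuit.gateVal_of_prod _ hgate, RGate.eval, List.map_map]
      congr 1
      refine List.map_congr_left fun u hu => ?_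
      simp only [Function.comp_apply]
      rw [R.opVal_tr u fun r' hr' => hreads r' ?_]
      simp only [RGate.reads, List.mem_flatMap]
      exact ⟨u, hu, hr'⟩

/-- **Correctness of compilation at a register**: the gate at the position of a register `r` of
the program has value `val r`. [cite: Burgisser2000, Def. 2.1] -/
theorem gateVal_compile_pos {val : ρ → MvPolynomial σ k} (hW : R.WellRanked) (hV : R.Realizes val)
    {r : ρ} (hr : r ∈ R.regs) : R.compile.gateVal (R.pos r) = val r := by
  rw [R.gateVal_compile_sorted hW hV _ (R.pos_lt_length hr), R.getElem_pos hr]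

/-- **The compiled circuit computes the value of the output operand.** [cite: Burgisser2000, Def. 2.1] -/
theorem eval_compile {val : ρ → MvPolynomial σ k} (hW : R.WellRanked) (hV : R.Realizes val)
    (hout : ∀ r' ∈ R.output.reads, r' ∈ R.regs) : R.compile.eval = R.output.eval val := by
  rw [ArithCircuit.eval_eq_opVal_output]
  refine R.opVal_tr R.output fun r' hr' => ⟨?_, R.gateVal_compile_pos hW hV (hout r' hr')⟩
  rw [size_compile, ← length_sorted]
  exact R.pos_lt_length (hout r' hr')

end RegProg

end Reg

end ArithCircuit


/-! ## Part 3. The Mahajan–Vinay register program for the determinant `det_{m+1}` -/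

namespace HI16Det

open ArithCircuit GKKP2011 Berkowitz Finset

/-- The registers of the determinant program (`e` = layer of the dynamics already computed,
`(t, u)` = state (head, current vertex), `w` = summation index, `j` = length of a partial sum):
`bm e t` = boundary mass `B_e(t)`, `pr e t u w` = the `w`-th product feeding `sv (e+1) t u`,
`acc e t u j` = its `j`-th partial sum (so `acc e t u t = sv (e+1) t u`), `out j` = the signed
partial trace `ε ∑_{t ≤ j} sv n t t`. [cite: MahajanVinay1997, §3] -/
inductive Reg : Type
  /-- boundary mass `bmass (sv e) e t` -/
  | bm (e t : ℕ) : Reg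
  /-- the product `src e t w · X_{w u}` -/
  | pr (e t u w : ℕ) : Reg
  /-- the signed partial sum `sgn · ∑_{w' ≤ j} src e t w' · X_{w' u}` -/
  | acc (e t u j : ℕ) : Reg
  /-- the signed partial trace `ε · ∑_{t ≤ j} sv n t t` -/
  | out (j : ℕ) : Reg
  deriving DecidableEq

variable (m : ℕ)

/-- The input operand `X_{(w,u)}` of the generic `(m+1) × (m+1)` matrix, the constant `0` out of
range (matching `Berkowitz.xvar`). [cite: MahajanVinay1997, §3] -/
def xop (w u : ℕ) : ROperand ℤ (Fin (m + 1) × Fin (m + 1)) Reg :=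
  if h : w < m + 1 ∧ u < m + 1 then .var (⟨w, h.1⟩, ⟨u, h.2⟩) else .const 0

/-- The operand holding `sv e t w`: the constant `0` at layer `0`, else the full partial sum
`acc (e-1) t w t`. [cite: MahajanVinay1997, §3] -/
def svOp : ℕ → ℕ → ℕ → ROperand ℤ (Fin (m + 1) × Fin (m + 1)) Reg
  | 0, _, _ => .const 0
  | e + 1, t, w => .reg (.acc e t w t)

/-- The operand holding the source of the `w`-th product: `sv e t w` for `w < t`, the boundary
mass `bm e t` for `w = t`. [cite: MahajanVinay1997, §3] -/
def srcOp (e t w : ℕ) : ROperand ℤ (Fin (m + 1) × Fin (m + 1)) Reg :=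
  if w < t then svOp m e t w else .reg (.bm e t)

/-- The sign of the step into the state `(t, u)`: `+1` to continue the clow (`u < t`), `-1` to
close it (`u = t`). [cite: MahajanVinay1997, §3] -/
def sgn (t u : ℕ) : ℤ := if u < t then 1 else -1

/-- The global sign `(-1)^{m+1}` converting `[X^0] χ` into `det`. [cite: MahajanVinay1997, §3] -/
def eps : ℤ := (-1) ^ (m + 1)

/-- The defining gates: prefix sums for the boundary masses, one skew product per summand of the
dynamics, fan-in-two accumulation with the sign as coefficient, and the signed trace.
[cite: MahajanVinay1997, §3] -/
def gateOf : Reg → RGate ℤ (Fin (m + 1) × Fin (m + 1)) Reg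
  | .bm e 0 => .sum (if e = 0 then [(1, .const 1)] else [])
  | .bm e (t + 1) => .sum [(1, .reg (.bm e t)), (1, svOp m e t t)]
  | .pr e t u w => .prod [srcOp m e t w, xop m w u]
  | .acc e t u 0 => .sum [(sgn t u, .reg (.pr e t u 0))]
  | .acc e t u (j + 1) => .sum [(1, .reg (.acc e t u j)), (sgn t u, .reg (.pr e t u (j + 1)))]
  | .out 0 => .sum [(eps m, .reg (.acc m 0 0 0))]
  | .out (j + 1) => .sum [(1, .reg (.out j)), (eps m, .reg (.acc m (j + 1) (j + 1) (j + 1)))]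

/-- The rank: layer-major; inside a layer the boundary masses, then the products, then the
partial sums by length; the trace last. [cite: MahajanVinay1997, §3] -/
def rank : Reg → ℕ
  | .bm e t => e * (2 * m + 4) + t
  | .pr e _ _ _ => e * (2 * m + 4) + (m + 1)
  | .acc e _ _ j => e * (2 * m + 4) + (m + 2) + j
  | .out j => (m + 1) * (2 * m + 4) + j

/-- The source of the `w`-th product as a polynomial. [cite: MahajanVinay1997, §3] -/
def src (e t w : ℕ) : MvPolynomial (Fin (m + 1) × Fin (m + 1)) ℤ :=
  if w < t then sv ℤ (m + 1) e t w else bmass ℤ (m + 1) (sv ℤ (m + 1) e) e t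

/-- The intended values of the registers, in terms of the tree's clow dynamics `GKKP2011.sv`.
[cite: MahajanVinay1997, §3] -/
def val : Reg → MvPolynomial (Fin (m + 1) × Fin (m + 1)) ℤ
  | .bm e t => bmass ℤ (m + 1) (sv ℤ (m + 1) e) e t
  | .pr e t u w => src m e t w * xvar ℤ (m + 1) w u
  | .acc e t u j => sgn t u • ∑ w ∈ range (j + 1), src m e t w * xvar ℤ (m + 1) w u
  | .out j => eps m • ∑ t ∈ range (j + 1), sv ℤ (m + 1) (m + 1) t t

/-- The product registers of layer `e`. [cite: MahajanVinay1997, §3] -/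
def prBlock (e : ℕ) : List Reg :=
  (List.range (m + 1)).flatMap fun t => (List.range (t + 1)).flatMap fun u =>
    (List.range (t + 1)).map fun w => .pr e t u w

/-- The partial-sum registers of layer `e`. [cite: MahajanVinay1997, §3] -/
def accBlock (e : ℕ) : List Reg :=
  (List.range (m + 1)).flatMap fun t => (List.range (t + 1)).flatMap fun u =>
    (List.range (t + 1)).map fun j => .acc e t u j

/-- All registers of layer `e`. [cite: MahajanVinay1997, §3] -/
def stage (e : ℕ) : List Reg :=
  (List.range (m + 1)).map (.bm e) ++ prBlock m e ++ accBlock m e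

/-- All registers of the determinant program. [cite: MahajanVinay1997, §3] -/
def regs : List Reg :=
  (List.range (m + 1)).flatMap (stage m) ++ (List.range (m + 1)).map .out

/-- **The register program for `det_{m+1}`.** [cite: MahajanVinay1997, §3] -/
def prog : RegProg ℤ (Fin (m + 1) × Fin (m + 1)) Reg where
  regs := regs m
  rank := rank m
  gateOf := gateOf m
  output := .reg (.out m)

/-- **The skew constant-free circuit for `det_{m+1}`.** [cite: MahajanVinay1997, §3] -/
def detCircuit : ArithCircuit ℤ (Fin (m + 1) × Fin (m + 1)) :=
  (prog m).compile

/-! ### Membership in the register list -/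

variable {m}

/-- The boundary-mass registers present: layers `e ≤ m`, heads `t ≤ m`. [cite: MahajanVinay1997, §3] -/
theorem mem_regs_bm {e t : ℕ} : Reg.bm e t ∈ regs m ↔ e ≤ m ∧ t ≤ m := by
  simp [regs, stage, prBlock, accBlock]

/-- The product registers present: states `u ≤ t ≤ m`, summands `w ≤ t`. [cite: MahajanVinay1997, §3] -/
theorem mem_regs_pr {e t u w : ℕ} : Reg.pr e t u w ∈ regs m ↔ e ≤ m ∧ t ≤ m ∧ u ≤ t ∧ w ≤ t := by
  simp [regs, stage, prBlock, accBlock]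

/-- The partial-sum registers present: states `u ≤ t ≤ m`, lengths `j ≤ t`. [cite: MahajanVinay1997, §3] -/
theorem mem_regs_acc {e t u j : ℕ} : Reg.acc e t u j ∈ regs m ↔ e ≤ m ∧ t ≤ m ∧ u ≤ t ∧ j ≤ t := by
  simp [regs, stage, prBlock, accBlock]

/-- The trace registers present: `j ≤ m`. [cite: MahajanVinay1997, §3] -/
theorem mem_regs_out {j : ℕ} : Reg.out j ∈ regs m ↔ j ≤ m := by
  simp [regs, stage, prBlock, accBlock]

/-! ### The local equations -/

/-- The input operand reads the matrix entry `xvar`. [cite: MahajanVinay1997, §3] -/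
theorem eval_xop (V : Reg → MvPolynomial (Fin (m + 1) × Fin (m + 1)) ℤ) (w u : ℕ) :
    (xop m w u).eval V = xvar ℤ (m + 1) w u := by
  unfold xop xvar
  split_ifs <;> simp

/-- **The full partial sum is the next layer of the dynamics**: `val (acc e t u t) = sv (e+1) t u`
for `u ≤ t` (one step `GKKP2011.sv_succ` of the signed clow dynamics, the sign of a closing edge
moved from the edge weight `stepW` to the sum coefficient `sgn`). [cite: MahajanVinay1997, §3] -/
theorem val_acc_self {e t u : ℕ} (hu : u ≤ t) :
    val m (.acc e t u t) = sv ℤ (m + 1) (e + 1) t u := by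
  rw [val, sv_succ, stepOp, Finset.sum_range_succ]
  have hsrc : ∀ w ∈ range t, src m e t w * xvar ℤ (m + 1) w u = sv ℤ (m + 1) e t w * xvar ℤ (m + 1) w u :=
    fun w hw => by rw [src, if_pos (mem_range.1 hw)]
  have hsrc_t : src m e t t = bmass ℤ (m + 1) (sv ℤ (m + 1) e) e t := by
    rw [src, if_neg (lt_irrefl t)]
  rw [Finset.sum_congr rfl hsrc, hsrc_t]
  rcases hu.lt_or_eq with hlt | rfl
  · have hsgn : sgn t u = 1 := if_pos hlt
    have hstep : ∀ w, stepW ℤ (m + 1) w t u = xvar ℤ (m + 1) w u := fun w => by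
      rw [stepW, if_pos hlt]
    simp_rw [hsgn, one_smul, hstep]
  · have hsgn : sgn u u = -1 := if_neg (lt_irrefl u)
    have hstep : ∀ w, stepW ℤ (m + 1) w u u = -xvar ℤ (m + 1) w u := fun w => by
      rw [stepW, if_neg (lt_irrefl u), if_pos rfl]
    simp_rw [hsgn, neg_one_zsmul, hstep, mul_neg, Finset.sum_neg_distrib, neg_add]

/-- The operand `svOp e t w` reads `sv e t w` (for `w ≤ t`). [cite: MahajanVinay1997, §3] -/
theorem eval_svOp {e t w : ℕ} (hw : w ≤ t) : (svOp m e t w).eval (val m) = sv ℤ (m + 1) e t w := by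
  cases e with
  | zero => simp [svOp, ROperand.eval, sv]
  | succ e => exact val_acc_self hw

/-- The operand `srcOp e t w` reads `src e t w`. [cite: MahajanVinay1997, §3] -/
theorem eval_srcOp (e t w : ℕ) : (srcOp m e t w).eval (val m) = src m e t w := by
  unfold srcOp src
  split_ifs with h
  · exact eval_svOp h.le
  · rfl

/-- The boundary mass at layer `0` is `1`, at `t = 0` it is `[e = 0]`, and it is a prefix sum.
[cite: MahajanVinay1997, §3] -/
theorem bmass_succ (e t : ℕ) :
    bmass ℤ (m + 1) (sv ℤ (m + 1) e) e (t + 1) =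
      bmass ℤ (m + 1) (sv ℤ (m + 1) e) e t + sv ℤ (m + 1) e t t := by
  simp [bmass, Finset.sum_range_succ, add_assoc]

/-- **The local equations hold**: every defining gate, evaluated at the intended values, returns
the intended value of its register. [cite: MahajanVinay1997, §3] -/
theorem realizes : (prog m).Realizes (val m) := by
  intro r
  change (gateOf m r).eval (val m) = val m r
  rcases r with ⟨e, t⟩ | ⟨e, t, u, w⟩ | ⟨e, t, u, j⟩ | j
  · -- boundary masses
    cases t with
    | zero =>
      rw [val]
      rcases Nat.eq_zero_or_pos e with rfl | he
      · simp [gateOf, RGate.eval, bmass]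
      · simp [gateOf, RGate.eval, bmass, he.ne']
    | succ t =>
      rw [val, bmass_succ]
      simp only [gateOf, RGate.eval, List.map_cons, List.map_nil, List.sum_cons, List.sum_nil,
        add_zero, one_smul, ROperand.eval_reg, eval_svOp le_rfl, val]
  · -- products
    simp only [gateOf, RGate.eval, List.map_cons, List.map_nil, List.prod_cons, List.prod_nil,
      mul_one, eval_srcOp, eval_xop, val]
  · -- partial sums
    cases j with
    | zero =>
      simp only [gateOf, RGate.eval, List.map_cons, List.map_nil, List.sum_cons, List.sum_nil,
        add_zero, ROperand.eval_reg, val, zero_add, Finset.sum_range_one]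
    | succ j =>
      simp only [gateOf, RGate.eval, ROperand.eval_reg, val, List.map_cons, List.map_nil,
        List.sum_cons, List.sum_nil, add_zero, one_smul]
      rw [Finset.sum_range_succ _ (j + 1), smul_add]
  · -- the signed trace
    cases j with
    | zero =>
      simp only [gateOf, RGate.eval, List.map_cons, List.map_nil, List.sum_cons, List.sum_nil,
        add_zero, ROperand.eval_reg, val_acc_self le_rfl]
      simp only [val, zero_add, Finset.sum_range_one]
    | succ j =>
      simp only [gateOf, RGate.eval, ROperand.eval_reg, List.map_cons, List.map_nil,
        List.sum_cons, List.sum_nil, add_zero, one_smul, val_acc_self le_rfl]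
      simp only [val]
      rw [Finset.sum_range_succ _ (j + 1), smul_add]

/-! ### Well-rankedness -/

/-- The registers read by the operands. [cite: MahajanVinay1997, §3] -/
theorem reads_xop (w u : ℕ) : (xop m w u).reads = [] := by
  unfold xop
  split_ifs <;> rfl

/-- At layer `0` the operand `svOp` is a constant and reads nothing. [cite: MahajanVinay1997, §3] -/
theorem reads_svOp_zero (t w : ℕ) : (svOp m 0 t w).reads = [] := rfl

/-- At layer `e+1` the operand `svOp` reads the full partial sum of layer `e`. [cite: MahajanVinay1997, §3] -/
theorem reads_svOp_succ (e t w : ℕ) : (svOp m (e + 1) t w).reads = [.acc e t w t] := rfl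

/-- **The program is well ranked**: every register reads only registers of the program of
smaller rank. [cite: MahajanVinay1997, §3] -/
theorem wellRanked : (prog m).WellRanked := by
  intro r hr r' hr'
  change r ∈ regs m at hr
  change r' ∈ (gateOf m r).reads at hr'
  change r' ∈ regs m ∧ rank m r' < rank m r
  rcases r with ⟨e, t⟩ | ⟨e, t, u, w⟩ | ⟨e, t, u, j⟩ | j
  · rw [mem_regs_bm] at hr
    cases t with
    | zero =>
      simp only [gateOf] at hr'
      split_ifs at hr' <;> simp [RGate.reads] at hr'
    | succ t =>
      cases e with
      | zero =>
        simp only [gateOf, RGate.reads, List.flatMap_cons, List.flatMap_nil, ROperand.reads_reg,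
          reads_svOp_zero, List.append_nil, List.mem_singleton] at hr'
        subst hr'
        exact ⟨mem_regs_bm.2 ⟨hr.1, by omega⟩, by simp [rank]⟩
      | succ e =>
        simp only [gateOf, RGate.reads, List.flatMap_cons, List.flatMap_nil, ROperand.reads_reg,
          reads_svOp_succ, List.append_nil, List.singleton_append, List.mem_cons,
          List.not_mem_nil, or_false] at hr'
        rcases hr' with rfl | rfl
        · exact ⟨mem_regs_bm.2 ⟨hr.1, by omega⟩, by simp [rank]⟩
        · refine ⟨mem_regs_acc.2 ⟨by omega, by omega, le_rfl, le_rfl⟩, ?_⟩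
          simp only [rank]; ring_nf; omega
  · rw [mem_regs_pr] at hr
    simp only [gateOf, RGate.reads, List.flatMap_cons, List.flatMap_nil, List.append_nil,
      reads_xop, srcOp] at hr'
    split_ifs at hr' with hwt
    · cases e with
      | zero => simp [reads_svOp_zero] at hr'
      | succ e =>
        simp only [reads_svOp_succ, List.mem_singleton] at hr'
        subst hr'
        refine ⟨mem_regs_acc.2 ⟨by omega, hr.2.1, hwt.le, le_rfl⟩, ?_⟩
        simp only [rank]; ring_nf; omega
    · simp only [ROperand.reads_reg, List.mem_singleton] at hr'
      subst hr'
      exact ⟨mem_regs_bm.2 ⟨hr.1, hr.2.1⟩, by simp only [rank]; omega⟩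
  · rw [mem_regs_acc] at hr
    cases j with
    | zero =>
      simp only [gateOf, RGate.reads, List.flatMap_cons, List.flatMap_nil, ROperand.reads_reg,
        List.append_nil, List.mem_singleton] at hr'
      subst hr'
      exact ⟨mem_regs_pr.2 ⟨hr.1, hr.2.1, hr.2.2.1, Nat.zero_le _⟩, by simp only [rank]; omega⟩
    | succ j =>
      simp only [gateOf, RGate.reads, List.flatMap_cons, List.flatMap_nil, ROperand.reads_reg,
        List.append_nil, List.singleton_append, List.mem_cons, List.not_mem_nil, or_false] at hr'
      rcases hr' with rfl | rfl
      · exact ⟨mem_regs_acc.2 ⟨hr.1, hr.2.1, hr.2.2.1, by omega⟩, by simp only [rank]; omega⟩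
      · exact ⟨mem_regs_pr.2 ⟨hr.1, hr.2.1, hr.2.2.1, hr.2.2.2⟩, by simp only [rank]; omega⟩
  · rw [mem_regs_out] at hr
    cases j with
    | zero =>
      simp only [gateOf, RGate.reads, List.flatMap_cons, List.flatMap_nil, ROperand.reads_reg,
        List.append_nil, List.mem_singleton] at hr'
      subst hr'
      refine ⟨mem_regs_acc.2 ⟨le_rfl, Nat.zero_le _, le_rfl, le_rfl⟩, ?_⟩
      simp only [rank]; ring_nf; omega
    | succ j =>
      simp only [gateOf, RGate.reads, List.flatMap_cons, List.flatMap_nil, ROperand.reads_reg,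
        List.append_nil, List.singleton_append, List.mem_cons, List.not_mem_nil, or_false] at hr'
      rcases hr' with rfl | rfl
      · exact ⟨mem_regs_out.2 (by omega), by simp only [rank]; omega⟩
      · refine ⟨mem_regs_acc.2 ⟨le_rfl, hr, le_rfl, le_rfl⟩, ?_⟩
        simp only [rank]; ring_nf; omega

/-! ### Shape: fan-in two, constant-free, skew; size -/

/-- Every defining gate has fan-in at most two. [cite: MahajanVinay1997, §3] -/
theorem fanIn_gateOf_le (r : Reg) : (gateOf m r).fanIn ≤ 2 := by
  rcases r with ⟨e, _ | t⟩ | ⟨e, t, u, w⟩ | ⟨e, t, u, _ | j⟩ | (_ | j) <;>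
    simp only [gateOf, RGate.fanIn, List.length_cons, List.length_nil] <;> try omega
  split <;> simp

/-- `1` is a sign constant. [cite: Burgisser2000, §1.4] -/
theorem isSignConstant_one : IsSignConstant (1 : ℤ) := Or.inr (Or.inl rfl)

/-- `0` is a sign constant. [cite: Burgisser2000, §1.4] -/
theorem isSignConstant_zero : IsSignConstant (0 : ℤ) := Or.inl rfl

/-- The step sign `±1` is a sign constant. [cite: Burgisser2000, §1.4] -/
theorem isSignConstant_sgn (t u : ℕ) : IsSignConstant (sgn t u) := by
  unfold sgn
  split_ifs
  · exact Or.inr (Or.inl rfl)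
  · exact Or.inr (Or.inr (by norm_num))

/-- The global sign `(-1)^{m+1}` is a sign constant. [cite: Burgisser2000, §1.4] -/
theorem isSignConstant_eps : IsSignConstant (eps m) := by
  rcases neg_one_pow_eq_or ℤ (m + 1) with h | h
  · exact Or.inr (Or.inl h)
  · exact Or.inr (Or.inr (by rw [eps, h]; norm_num))

/-- The input operand is a variable or the constant `0`. [cite: Burgisser2000, §1.4] -/
theorem hasSignConstants_xop (w u : ℕ) : (xop m w u).HasSignConstants := by
  unfold xop
  split_ifs
  · trivial
  · exact isSignConstant_zero

/-- The operand `svOp` is a register or the constant `0`. [cite: Burgisser2000, §1.4] -/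
theorem hasSignConstants_svOp (e t w : ℕ) : (svOp m e t w).HasSignConstants := by
  cases e with
  | zero => exact isSignConstant_zero
  | succ e => trivial

/-- The operand `srcOp` is a register or the constant `0`. [cite: Burgisser2000, §1.4] -/
theorem hasSignConstants_srcOp (e t w : ℕ) : (srcOp m e t w).HasSignConstants := by
  unfold srcOp
  split_ifs
  · exact hasSignConstants_svOp e t w
  · trivial

/-- **Every defining gate is constant-free** (constants `0, 1`, coefficients `1, ±1, (-1)^{m+1}`).
[cite: HuttenhainIkenmeyer2016, §5] -/
theorem hasSignConstants_gateOf (r : Reg) : (gateOf m r).HasSignConstants := by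
  rcases r with ⟨e, _ | t⟩ | ⟨e, t, u, w⟩ | ⟨e, t, u, _ | j⟩ | (_ | j)
  · simp only [gateOf, RGate.HasSignConstants]
    split_ifs
    · intro a ha
      simp only [List.mem_singleton] at ha
      subst ha
      exact ⟨isSignConstant_one, isSignConstant_one⟩
    · intro a ha
      simp at ha
  · intro a ha
    simp only [List.mem_cons, List.not_mem_nil, or_false] at ha
    rcases ha with rfl | rfl
    · exact ⟨isSignConstant_one, trivial⟩
    · exact ⟨isSignConstant_one, hasSignConstants_svOp e t t⟩
  · intro a ha
    simp only [List.mem_cons, List.not_mem_nil, or_false] at ha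
    rcases ha with rfl | rfl
    · exact hasSignConstants_srcOp e t w
    · exact hasSignConstants_xop w u
  · intro a ha
    simp only [List.mem_singleton] at ha
    subst ha
    exact ⟨isSignConstant_sgn t u, trivial⟩
  · intro a ha
    simp only [List.mem_cons, List.not_mem_nil, or_false] at ha
    rcases ha with rfl | rfl
    · exact ⟨isSignConstant_one, trivial⟩
    · exact ⟨isSignConstant_sgn t u, trivial⟩
  · intro a ha
    simp only [List.mem_singleton] at ha
    subst ha
    exact ⟨isSignConstant_eps, trivial⟩
  · intro a ha
    simp only [List.mem_cons, List.not_mem_nil, or_false] at ha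
    rcases ha with rfl | rfl
    · exact ⟨isSignConstant_one, trivial⟩
    · exact ⟨isSignConstant_eps, trivial⟩

/-- The input operand is never a register reference. [cite: HuttenhainIkenmeyer2016, §5] -/
theorem isRegRef_xop (w u : ℕ) : (xop m w u).isRegRef = false := by
  unfold xop
  split_ifs <;> rfl

/-- **Every product gate is skew**: its second operand is an input. [cite: HuttenhainIkenmeyer2016, §5] -/
theorem isSkew_gateOf (r : Reg) : (gateOf m r).IsSkew := by
  rcases r with ⟨e, _ | t⟩ | ⟨e, t, u, w⟩ | ⟨e, t, u, _ | j⟩ | (_ | j) <;> try trivial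
  simp only [gateOf, RGate.IsSkew]
  rw [List.countP_cons, List.countP_cons, List.countP_nil, isRegRef_xop]
  cases (srcOp m e t w).isRegRef <;> simp

/-- Length of a `flatMap` with uniformly bounded pieces. [folklore] -/
private theorem length_flatMap_le {α β : Type*} (l : List α) (f : α → List β) (B : ℕ)
    (h : ∀ a ∈ l, (f a).length ≤ B) : (l.flatMap f).length ≤ l.length * B := by
  induction l with
  | nil => simp
  | cons a l ih =>
    simp only [List.flatMap_cons, List.length_append, List.length_cons]
    have h1 := h a (by simp)
    have h2 := ih fun b hb => h b (by simp [hb])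
    rw [Nat.succ_mul]
    omega

/-- At most `(m+1)^3` product registers per layer. [cite: MahajanVinay1997, §3] -/
theorem length_prBlock_le (e : ℕ) : (prBlock m e).length ≤ (m + 1) * ((m + 1) * (m + 1)) := by
  unfold prBlock
  refine (length_flatMap_le _ _ _ fun t ht => ?_).trans (by rw [List.length_range])
  have ht' : t < m + 1 := List.mem_range.1 ht
  refine (length_flatMap_le _ _ (m + 1) fun u _ => ?_).trans ?_
  · rw [List.length_map, List.length_range]; omega
  · rw [List.length_range]
    exact Nat.mul_le_mul_right _ (by omega)

/-- At most `(m+1)^3` partial-sum registers per layer. [cite: MahajanVinay1997, §3] -/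
theorem length_accBlock_le (e : ℕ) : (accBlock m e).length ≤ (m + 1) * ((m + 1) * (m + 1)) := by
  unfold accBlock
  refine (length_flatMap_le _ _ _ fun t ht => ?_).trans (by rw [List.length_range])
  have ht' : t < m + 1 := List.mem_range.1 ht
  refine (length_flatMap_le _ _ (m + 1) fun u _ => ?_).trans ?_
  · rw [List.length_map, List.length_range]; omega
  · rw [List.length_range]
    exact Nat.mul_le_mul_right _ (by omega)

/-- The determinant program has at most `4 (m+1)^4` registers. [cite: MahajanVinay1997, §3] -/
theorem length_regs_le : (regs m).length ≤ 4 * (m + 1) ^ 4 := by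
  have hstage : ∀ e, (stage m e).length ≤ (m + 1) + 2 * (m + 1) ^ 3 := fun e => by
    simp only [stage, List.length_append, List.length_map, List.length_range]
    have h1 := length_prBlock_le (m := m) e
    have h2 := length_accBlock_le (m := m) e
    have h3 : (m + 1) * ((m + 1) * (m + 1)) = (m + 1) ^ 3 := by ring
    omega
  have hreg : (regs m).length ≤ (m + 1) * ((m + 1) + 2 * (m + 1) ^ 3) + (m + 1) := by
    simp only [regs, List.length_append, List.length_map, List.length_range]
    have := length_flatMap_le (List.range (m + 1)) (stage m) _ fun e _ => hstage e
    rw [List.length_range] at this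
    omega
  refine hreg.trans ?_
  have h1 : (m + 1) ≤ (m + 1) ^ 4 := by
    calc (m + 1) = (m + 1) ^ 1 := (pow_one _).symm
      _ ≤ (m + 1) ^ 4 := Nat.pow_le_pow_right (Nat.succ_pos m) (by norm_num)
  have h2 : (m + 1) * (m + 1) ≤ (m + 1) ^ 4 := by
    calc (m + 1) * (m + 1) = (m + 1) ^ 2 := (sq _).symm
      _ ≤ (m + 1) ^ 4 := Nat.pow_le_pow_right (Nat.succ_pos m) (by norm_num)
  have h3 : (m + 1) * ((m + 1) + 2 * (m + 1) ^ 3) = (m + 1) * (m + 1) + 2 * (m + 1) ^ 4 := by ring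
  omega

/-! ### The circuit for `det_{m+1}` -/

/-- **`detCircuit m` computes `det_{m+1}`**: the signed trace of the last layer of the clow
dynamics is `[X^0] χ(M_{m+1}) = (-1)^{m+1} det_{m+1}` (`GKKP2011.sum_sv_diag`,
Mahajan–Vinay 1997, §3, Thm. 2). [cite: MahajanVinay1997, §3 Thm 2] -/
theorem detCircuit_computes : (detCircuit m).Computes (detPoly (Fin (m + 1)) ℤ) := by
  unfold ArithCircuit.Computes detCircuit
  rw [(prog m).eval_compile (wellRanked (m := m)) (realizes (m := m))
    (fun r' hr' => by
      simp only [prog, ROperand.reads, List.mem_singleton] at hr'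
      subst hr'
      exact mem_regs_out.2 le_rfl)]
  change val m (.out m) = _
  rw [val, sum_sv_diag, if_neg (Nat.succ_ne_zero m), sub_zero, detPoly, ← genBlock_self,
    Matrix.det_eq_sign_charpoly_coeff, Fintype.card_fin, chi, eps, zsmul_eq_mul]
  push_cast
  ring

/-- Shape and size of `detCircuit m`. [cite: MahajanVinay1997, §3] -/
theorem detCircuit_spec :
    (detCircuit m).IsFanInTwo ∧ (detCircuit m).HasSignConstants ∧ (detCircuit m).IsSkew ∧
      (detCircuit m).Computes (detPoly (Fin (m + 1)) ℤ) ∧ (detCircuit m).size ≤ 4 * (m + 1) ^ 4 := by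
  refine ⟨(prog m).isFanInTwo_compile fun r _ => fanIn_gateOf_le r,
    (prog m).hasSignConstants_compile (fun r _ => hasSignConstants_gateOf r) trivial,
    (prog m).isSkew_compile fun r _ => isSkew_gateOf r, detCircuit_computes, ?_⟩
  rw [detCircuit, RegProg.size_compile]
  exact length_regs_le

end HI16Det

/-! ## Part 4. `DET⁰ ⊆ VP_s⁰` -/

section DetZero

open ArithCircuit

/-- **A constant-free skew circuit of size `O(s⁴)` for the generic determinant `det_s`**
(Mahajan–Vinay 1997, §3: the determinant has polynomial-size skew circuits / branching programs;
here `≤ 4 (s+1)^4` gates, fan-in two, constants in `{0, 1, -1}`). [cite: MahajanVinay1997, §3 Thm 2] -/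
theorem exists_skew_circuit_detPoly (s : ℕ) :
    ∃ P : ArithCircuit ℤ (Fin s × Fin s), P.IsFanInTwo ∧ P.HasSignConstants ∧ P.IsSkew ∧
      P.Computes (detPoly (Fin s) ℤ) ∧ P.size ≤ 4 * (s + 1) ^ 4 := by
  cases s with
  | zero =>
    refine ⟨ofConst 1, fun g hg => by simp [ofConst] at hg, ⟨fun g hg => by simp [ofConst] at hg,
      Or.inr (Or.inl rfl)⟩, fun g hg => by simp [ofConst] at hg, ?_, by simp⟩
    rw [ArithCircuit.Computes, eval_ofConst, detPoly, Matrix.det_isEmpty, map_one]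
  | succ m =>
    obtain ⟨h1, h2, h3, h4, h5⟩ := HI16Det.detCircuit_spec (m := m)
    exact ⟨HI16Det.detCircuit m, h1, h2, h3, h4,
      h5.trans (Nat.mul_le_mul_left _ (Nat.pow_le_pow_left (by omega) _))⟩

variable {σ : Type*}

/-- **A binary variable matrix has a constant-free skew circuit of size `O(s⁴)` for its
determinant**: substitute the entries `0, 1, X v` for the variables of the circuit for `det_s`.
[cite: HuttenhainIkenmeyer2016, Prop. 5.2 (proof, `DET⁰ ⊆ VP_s⁰`)] -/
theorem exists_skew_circuit_of_hasBinaryDetRepr {g : MvPolynomial σ ℤ} {s : ℕ}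
    (h : HasBinaryDetRepr g s) :
    ∃ P : ArithCircuit ℤ σ, P.IsFanInTwo ∧ P.HasSignConstants ∧ P.IsSkew ∧ P.Computes g ∧
      P.size ≤ 4 * (s + 1) ^ 4 := by
  classical
  obtain ⟨A, hA, rfl⟩ := h
  obtain ⟨P, h1, h2, h3, h4, h5⟩ := exists_skew_circuit_detPoly s
  -- the inputs: the variable `v` for an entry `X v`, else the constant `1` or `0`
  let φ : Fin s × Fin s → σ ⊕ ℤ := fun ij =>
    if hv : ∃ v, A ij.1 ij.2 = X v then .inl hv.choose
    else if A ij.1 ij.2 = 1 then .inr 1 else .inr 0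
  have hφval : ∀ ij, inputVal φ ij = A ij.1 ij.2 := by
    intro ij
    by_cases hv : ∃ v, A ij.1 ij.2 = X v
    · have hφ : φ ij = .inl hv.choose := by simp only [φ, dif_pos hv]
      rw [inputVal_of_inl hφ]
      exact hv.choose_spec.symm
    · rcases hA ij.1 ij.2 with h0 | h1' | ⟨v, hv'⟩
      · have hne : A ij.1 ij.2 ≠ 1 := by rw [h0]; exact zero_ne_one
        have hφ : φ ij = .inr 0 := by simp only [φ, dif_neg hv, if_neg hne]
        rw [inputVal_of_inr hφ, h0, map_zero]
      · have hφ : φ ij = .inr 1 := by simp only [φ, dif_neg hv, if_pos h1']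
        rw [inputVal_of_inr hφ, h1', map_one]
      · exact absurd ⟨v, hv'⟩ hv
  have hφsign : SignInputs φ := by
    intro ij c hc
    by_cases hv : ∃ v, A ij.1 ij.2 = X v
    · simp only [φ, dif_pos hv] at hc
      exact absurd hc Sum.inl_ne_inr
    · by_cases h1' : A ij.1 ij.2 = 1
      · simp only [φ, dif_neg hv, if_pos h1', Sum.inr.injEq] at hc
        rw [← hc]
        exact Or.inr (Or.inl rfl)
      · simp only [φ, dif_neg hv, if_neg h1', Sum.inr.injEq] at hc
        rw [← hc]
        exact Or.inl rfl
  refine ⟨P.substIn φ, h1.substIn φ, h2.substIn hφsign, h3.substIn φ, ?_, by rwa [size_substIn]⟩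
  rw [ArithCircuit.Computes, eval_substIn, h4, detPoly, AlgHom.map_det]
  have hfun : inputVal φ = fun ij : Fin s × Fin s => A ij.1 ij.2 := funext hφval
  rw [hfun, Matrix.mvPolynomialX_mapMatrix_aeval]

/-- **Hüttenhain–Ikenmeyer 2016, Proposition 5.2, the inclusion `DET⁰ ⊆ VP_s⁰`**: a family with
polynomially bounded binary determinantal complexity has polynomial-size constant-free skew
circuits (of fan-in two). The source proves this inclusion "by [toda:92]"
(`paper:arxiv-1410.8202 p0009:L32`); AS PROVED here: the skew circuit for `det_s` is the
Mahajan–Vinay 1997 clow dynamics in Berkowitz's orientation (tree `GKKP2011.sv`), size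
`≤ 4 (s+1)^4`, followed by the input substitution `X_{ij} ↦ A_{ij} ∈ {0, 1, X v}`. No bound on the
number of variables is needed or used (cf. the caveat on `IsVPsZeroFamily`). The converse
inclusion (Toda's direction) is `isDETZeroFamily_of_isVPsZeroFamily` (cell val-lit, t14).
[cite: HuttenhainIkenmeyer2016, Prop. 5.2] -/
theorem isVPsZeroFamily_of_isDETZeroFamily {ς : ℕ → Type*} {f : ∀ n, MvPolynomial (ς n) ℤ}
    (hf : IsDETZeroFamily f) : IsVPsZeroFamily f := by
  obtain ⟨s, hs, hrepr⟩ := hf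
  choose P hP using fun n => exists_skew_circuit_of_hasBinaryDetRepr (hrepr n)
  refine ⟨P, fun n => ⟨(hP n).1, (hP n).2.1, (hP n).2.2.1, (hP n).2.2.2.1⟩, ?_⟩
  obtain ⟨a, b, hab⟩ := (IsPBounded.iff_exists_le_mul_succ_pow s).1 hs
  refine (IsPBounded.iff_exists_le_mul_succ_pow _).2 ⟨4 * (a + 1) ^ 4, b * 4, fun n => ?_⟩
  have h1 : s n + 1 ≤ (a + 1) * (n + 1) ^ b := by
    have : 1 ≤ (n + 1) ^ b := Nat.one_le_pow _ _ (Nat.succ_pos n)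
    nlinarith [hab n]
  calc (P n).size ≤ 4 * (s n + 1) ^ 4 := (hP n).2.2.2.2
    _ ≤ 4 * ((a + 1) * (n + 1) ^ b) ^ 4 := Nat.mul_le_mul_left _ (Nat.pow_le_pow_left h1 4)
    _ = 4 * (a + 1) ^ 4 * (n + 1) ^ (b * 4) := by rw [mul_pow, ← pow_mul, mul_assoc]

end DetZero

end Literature.Computability.AlgebraicComplexity
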